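import Literature.Topology.FourManifolds.MorseRelativeExistence
import HarnessLib

/-!
# Morse perturbations supported in an open set, on a possibly non-compact manifold

Topic `Literature/Topology/FourManifolds` (fact seat
`provefact-Literature.Geometry.Symplectic.Oba2016_s-add47373d4`: the Morse function on the
regular fibre of a Lefschetz fibration — a non-compact surface `F°` — must keep a prescribed
collar profile near the end and be Morse on a compact piece).  Everything is proved; no
definitions, no named facts.

* `exists_morse_perturbation_rel` — **Milnor 1965, Thm. 2.7 in relative form, without
  compactness of the manifold** (the compact case, relative to `closure V₁`, is
  `Literature.Topology.FourManifolds.exists_contMDiff_eqOn_nondegenerate` of `MorseRelativeExistence.lean`, whose chart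
  balls `exists_chartBall_tsupport_subset` and frozen iteration `exists_iterate_eqOn` are reused):
  for `f` smooth with `f < 1` at interior points, regular on the compact `Cl`, and a compact set
  `K` of interior points inside the open `O`, some smooth `g < 1` inside agrees with `f` on an
  open set containing `Oᶜ`, is regular on `Cl`, and has only nondegenerate critical points on
  `K` (the balls cover `K` only).

## References

* J. Milnor, *Lectures on the h-cobordism theorem*, Princeton (1965), §2, Lemmas A–C, Thm. 2.7
  and proof of Thm. 2.5. [MilnorHCobordism1965]
-/

open scoped Manifold ContDiff Topology
open Set Function Filter Metric

noncomputable section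

namespace Literature.Topology.FourManifolds

universe u

variable {E : Type*} [NormedAddCommGroup E] [NormedSpace ℝ E]
  {H : Type*} [TopologicalSpace H] {I : ModelWithCorners ℝ E H}
  {X : Type u} [TopologicalSpace X] [ChartedSpace H X]

variable [FiniteDimensional ℝ E] [MeasurableSpace E] [BorelSpace E] [T2Space X] [IsManifold I ∞ X]

/-! ### Milnor's Thm. 2.7, relative form -/

/-- **Morse perturbation relative to the complement of an open set** (Milnor 1965, Thm. 2.7 /
proof of Thm. 2.5, on a possibly non-compact manifold).  Let `f : X → ℝ` be smooth with `f < 1`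
at interior points and no critical point on the compact set `Cl`; let `K` be a compact set of
interior points and `O ⊇ K` open.  Then there is a smooth `g : X → ℝ`, `g < 1` at interior
points, equal to `f` on an open set containing `Oᶜ`, without critical points on `Cl`, all of
whose critical points in `K` are nondegenerate: cover `K` by finitely many chart balls whose
bumps avoid the complement of an open `O' ⊇ K` with `closure O' ⊆ O`, and iterate the generic
linear perturbations of Lemmas A–B keeping the function frozen off `O'`.
[cite: MilnorHCobordism1965, §2 Thm. 2.7 and proof of Thm. 2.5] -/
theorem exists_morse_perturbation_rel [LocallyCompactSpace X] {f : X → ℝ} (hf : ContMDiff I 𝓘(ℝ, ℝ) ∞ f)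
    (hlt : ∀ x, I.IsInteriorPoint x → f x < 1)
    {Cl : Set X} (hCl : IsCompact Cl) (hreg : ∀ x ∈ Cl, ¬ IsMCriticalPt I f x)
    {K : Set X} (hK : IsCompact K) (hKint : ∀ x ∈ K, I.IsInteriorPoint x)
    {O : Set X} (hO : IsOpen O) (hKO : K ⊆ O) :
    ∃ g : X → ℝ, ContMDiff I 𝓘(ℝ, ℝ) ∞ g ∧ (∀ x, I.IsInteriorPoint x → g x < 1) ∧
      (∃ V : Set X, IsOpen V ∧ Oᶜ ⊆ V ∧ ∀ x ∈ V, g x = f x) ∧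
      (∀ x ∈ Cl, ¬ IsMCriticalPt I g x) ∧
      ∀ x ∈ K, IsMCriticalPt I g x → (mhessian I g x).Nondegenerate := by
  classical
  -- an open `O'` with `K ⊆ O' ⊆ closure O' ⊆ O`; the frozen set `F = O'ᶜ`
  obtain ⟨O', hO'o, hKO', hO'O, -⟩ := exists_open_between_and_isCompact_closure hK hO hKO
  set F : Set X := O'ᶜ with hF
  have hFc : IsClosed F := hO'o.isClosed_compl
  -- balls centred at the points of `K`, bumps supported off `F`
  have hball : ∀ x : K, ∃ κ : ChartBall I X, κ.c = x.1 ∧ tsupport κ.ρ ⊆ Fᶜ := fun x =>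
    exists_chartBall_tsupport_subset hFc (fun h => h (hKO' x.2)) (hKint x.1 x.2)
  choose κ hκc hκT using hball
  have hcover : K ⊆ ⋃ x : K, (κ x).U := fun y hy => mem_iUnion.2 ⟨⟨y, hy⟩, by
    have := (κ ⟨y, hy⟩).c_mem_U
    rwa [hκc] at this⟩
  obtain ⟨t, ht⟩ := hK.elim_finite_subcover (fun x : K => (κ x).U) (fun x => (κ x).isOpen_U) hcover
  set balls : List (ChartBall I X) := t.toList.map κ with hballs
  have htodo : ∀ κ' ∈ balls, tsupport κ'.ρ ⊆ Fᶜ := by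
    intro κ' hκ'
    rw [hballs, List.mem_map] at hκ'
    obtain ⟨i, -, rfl⟩ := hκ'
    exact hκT i
  obtain ⟨g, hg, hgreg, hglt, hgeq, hggood⟩ := exists_iterate_eqOn Cl hCl F f balls [] htodo hf hreg
    hlt (fun x _ => rfl) (fun κ h => by simp at h)
  refine ⟨g, hg, hglt, ⟨(closure O')ᶜ, isClosed_closure.isOpen_compl,
    compl_subset_compl.2 hO'O, fun x hx => hgeq x fun h => hx (subset_closure h)⟩, hgreg,
    fun x hxK hx => ?_⟩
  -- a critical point of `K` lies in the open piece of a ball of the cover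
  obtain ⟨i, hit, hxi⟩ : ∃ i ∈ t, x ∈ (κ i).U := by
    have := ht hxK
    simp only [mem_iUnion, exists_prop] at this
    exact this
  set κ₀ := κ i with hκ₀
  have hκ₀mem : κ₀ ∈ balls := by
    rw [hballs, List.mem_map]; exact ⟨i, Finset.mem_toList.2 hit, rfl⟩
  have hgood : κ₀.Good g := hggood κ₀ (by simpa using hκ₀mem)
  have hxsrc : x ∈ (interiorExtChart I κ₀.c).source :=
    κ₀.mem_source_of_dist_le hxi.1
      (le_of_lt (lt_of_lt_of_le (mem_ball.1 hxi.2) (by linarith [κ₀.r_pos])))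
  have hd0 : fderiv ℝ (κ₀.fhat g) (extChartAt I κ₀.c x) = 0 := (κ₀.isMCriticalPt_iff hg hxsrc).1 hx
  have hinj : Injective (fderiv ℝ (fderiv ℝ (κ₀.fhat g)) (extChartAt I κ₀.c x)) :=
    hgood _ (κ₀.ext_mem_K_of_mem_U hxi) hd0
  exact (nondegenerate_mhessian_iff_of_isMCriticalPt (contMDiffOn_interiorExtChart I κ₀.c)
    (contMDiffOn_interiorExtChart_symm I κ₀.c) hg hxsrc (hKint x hxK) hx).2 hinj

end Literature.Topology.FourManifolds

end
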